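import Literature.NumberTheory.NumberFields.ClassNumberPExtensionOnePrime
import Literature.NumberTheory.NumberFields.CyclotomicClassNumberDivisibility
import HarnessLib

/-!
# `p ∣ h(ℚ(ζ_{p^b})) ⟺ p ∣ h(ℚ(ζ_{p^a}))` (Washington Cor. 10.5)

Topic `NumberTheory/NumberFields` (class field theory); namespace `Literature.NumberTheory.NumberFields`.
Theorem-only file (no definition, no named fact), unconditional; a consequence of Washington's
Thm. 10.4 (`ClassNumberPExtensionOnePrime.lean`) and of `h(ℚ(ζ_m)) ∣ h(ℚ(ζ_n))` for `m ∣ n`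
(`CyclotomicClassNumberDivisibility.lean`), with Mathlib's ramification of rational primes in
cyclotomic fields.

> Washington, *Introduction to Cyclotomic Fields*, Cor. 10.5: "`p ∣ h(ℚ(ζ_{pⁿ}))` for some `n ≥ 1`
> iff `p ∣ h(ℚ(ζ_{pⁿ}))` for all `n ≥ 1` iff `p ∣ h(ℚ(ζ_p))`" (`p` is irregular).  Proof: `ℚ(ζ_{pⁿ})/ℚ(ζ_p)`
> is a `p`-extension, totally ramified above `p` and unramified elsewhere (both fields are totally
> complex), so Thm. 10.4 and Prop. 4.11 apply.

## Main results (`p` prime, `p^{k+1} ≠ 2`, `K = ℚ(ζ_{p^{k+1}})`, `L = ℚ(ζ_{p^{k+1+j}})` any cyclotomic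
number fields of these levels)

* `dvd_classNumber_of_isCyclotomicExtension_prime_pow_of_dvd` — `p ∣ h_L ⟹ p ∣ h_K`;
* **`dvd_classNumber_iff_of_isCyclotomicExtension_prime_pow`** — `p ∣ h_K ⟺ p ∣ h_L`;
* `not_dvd_classNumber_of_isPGroup_of_rat` — a Galois `p`-extension of `ℚ` unramified at `∞` and
  outside one prime has class number prime to `p` (`h_ℚ = 1`).

## References

* L. C. Washington, *Introduction to Cyclotomic Fields*, 2nd ed., GTM 83 (1997), Thm. 10.4, Cor. 10.5. [Washington1997]
-/

noncomputable section

open NumberField IsDedekindDomain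
open scoped IsMulCommutative

namespace Literature.NumberTheory.NumberFields

/-- An extension of a totally complex field is unramified at the infinite places. [folklore] -/
private theorem isUnramifiedAtInfinitePlaces_of_isTotallyComplex (K L : Type*) [Field K] [Field L]
    [Algebra K L] [IsTotallyComplex K] : IsUnramifiedAtInfinitePlaces K L :=
  ⟨fun w => InfinitePlace.isUnramified_iff.mpr
    (Or.inr (IsTotallyComplex.isComplex (w.comap (algebraMap K L))))⟩

/-- **`p ∣ h(ℚ(ζ_{p^{k+1+j}})) ⟹ p ∣ h(ℚ(ζ_{p^{k+1}}))`** (Washington Cor. 10.5, `⟸` half of the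
equivalence; `p^{k+1} ≠ 2`).  Inside `L = ℚ(ζ)`, `ζ` a primitive `p^{k+1+j}`-th root of unity, the
subfield `K₀ = ℚ(ζ^{p^j})` is `{p^{k+1}}`-cyclotomic and totally complex; `L/K₀` is a Galois
`p`-extension (`[L:K₀] = p^j`) unramified outside the unique prime `(ζ₀ - 1)` of `K₀` above `p`
(Mathlib: `e(q, L) = 1` for `q ≠ p`), so Thm. 10.4 applies. [cite: Washington1997, Cor. 10.5] -/
theorem dvd_classNumber_of_isCyclotomicExtension_prime_pow_of_dvd {p k j : ℕ} (hp : p.Prime)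
    (h2 : p ^ (k + 1) ≠ 2) (K L : Type) [Field K] [NumberField K] [Field L] [NumberField L]
    [IsCyclotomicExtension {p ^ (k + 1)} ℚ K] [hL : IsCyclotomicExtension {p ^ (k + 1 + j)} ℚ L]
    (hdvd : p ∣ classNumber L) : p ∣ classNumber K := by
  classical
  haveI : Fact p.Prime := ⟨hp⟩
  haveI : NeZero (p ^ (k + 1)) := ⟨pow_ne_zero _ hp.ne_zero⟩
  haveI : NeZero (p ^ (k + 1 + j)) := ⟨pow_ne_zero _ hp.ne_zero⟩
  -- the subfield `K₀ = ℚ(ζ^{p^j}) ≅ K` of `L`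
  have hζ := IsCyclotomicExtension.zeta_spec (p ^ (k + 1 + j)) ℚ L
  set ζ := IsCyclotomicExtension.zeta (p ^ (k + 1 + j)) ℚ L with hζdef
  have hζ₀ : IsPrimitiveRoot (ζ ^ p ^ j) (p ^ (k + 1)) :=
    hζ.pow (NeZero.pos _) (by rw [← pow_add]; congr 1; ring)
  set K₀ : IntermediateField ℚ L := IntermediateField.adjoin ℚ {ζ ^ p ^ j} with hK₀
  haveI hK₀c : IsCyclotomicExtension {p ^ (k + 1)} ℚ K₀ :=
    hζ₀.intermediateField_adjoin_isCyclotomicExtension ℚ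
  have hK : classNumber K = classNumber K₀ :=
    Fintype.card_congr (ClassGroup.mulEquiv (RingOfIntegers.mapRingEquiv
      (IsCyclotomicExtension.algEquiv {p ^ (k + 1)} ℚ K K₀).toRingEquiv)).toEquiv
  rw [hK]
  -- `L/K₀` is a Galois `p`-extension
  haveI : IsGalois ℚ L := IsCyclotomicExtension.isGalois {p ^ (k + 1 + j)} ℚ L
  haveI : IsGalois K₀ L := IsGalois.tower_top_of_isGalois ℚ K₀ L
  have hdeg : Module.finrank K₀ L = p ^ j := by
    have h := Module.finrank_mul_finrank ℚ K₀ L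
    rw [IsCyclotomicExtension.Rat.finrank (p ^ (k + 1)) K₀,
      IsCyclotomicExtension.Rat.finrank (p ^ (k + 1 + j)) L, Nat.totient_prime_pow_succ hp,
      show k + 1 + j = (k + j) + 1 by ring, Nat.totient_prime_pow_succ hp] at h
    have hpos : 0 < p ^ k * (p - 1) := Nat.mul_pos (pow_pos hp.pos k) (Nat.sub_pos_of_lt hp.one_lt)
    have h' : p ^ k * (p - 1) * Module.finrank K₀ L = p ^ k * (p - 1) * p ^ j := by
      rw [h]; ring
    exact Nat.eq_of_mul_eq_mul_left hpos h'
  have hG : IsPGroup p (L ≃ₐ[K₀] L) :=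
    IsPGroup.of_card (by rw [IsGalois.card_aut_eq_finrank, hdeg])
  -- `K₀` is totally complex (`p^{k+1} ≠ 2`), so `L/K₀` is unramified at the infinite places
  have hlt : 2 < p ^ (k + 1) := by
    have h1 : 2 ≤ p ^ (k + 1) := le_trans hp.two_le (Nat.le_self_pow (Nat.succ_ne_zero k) p)
    omega
  haveI : IsCMField K₀ := IsCyclotomicExtension.Rat.isCMField K₀ ⟨p ^ (k + 1), Set.mem_singleton _, hlt⟩
  haveI : IsUnramifiedAtInfinitePlaces K₀ L := isUnramifiedAtInfinitePlaces_of_isTotallyComplex K₀ L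
  -- the prime `v₀ = (ζ₀ - 1)` of `K₀` above `p`
  have hζK₀ := IsCyclotomicExtension.zeta_spec (p ^ (k + 1)) ℚ K₀
  let v₀ : HeightOneSpectrum (𝓞 K₀) :=
    ⟨Ideal.span {hζK₀.toInteger - 1}, IsCyclotomicExtension.Rat.isPrime_span_zeta_sub_one p k hζK₀,
      IsCyclotomicExtension.Rat.span_zeta_sub_one_ne_bot p k hζK₀⟩
  -- every prime of `L` not above `v₀` is unramified over `K₀`
  have hunr : ∀ (P : Ideal (𝓞 L)) [P.IsMaximal], P.under (𝓞 K₀) ≠ v₀.asIdeal →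
      Algebra.IsUnramifiedAt (𝓞 K₀) P := by
    intro P hP hne
    have hP0 : P ≠ ⊥ := Ring.ne_bot_of_isMaximal_of_not_isField hP (RingOfIntegers.not_isField L)
    -- the rational prime `q` below `P`
    haveI : (P.under ℤ).IsPrime := Ideal.IsPrime.under ℤ P
    have hPZ0 : P.under ℤ ≠ ⊥ := mt Ideal.eq_bot_of_comap_eq_bot hP0
    set g := Submodule.IsPrincipal.generator (P.under ℤ) with hgdef
    have hg : Ideal.span {g} = P.under ℤ := Ideal.span_singleton_generator (P.under ℤ)
    have hg0 : g ≠ 0 := fun h => hPZ0 (by rw [← hg, h, Ideal.span_singleton_eq_bot])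
    have hgprime : Prime g := (Ideal.span_singleton_prime hg0).mp (hg.symm ▸ inferInstance)
    set q := g.natAbs with hqdef
    have hq : q.Prime := Int.prime_iff_natAbs_prime.mp hgprime
    haveI : Fact q.Prime := ⟨hq⟩
    haveI hPq : P.LiesOver (Ideal.span {(q : ℤ)}) :=
      ⟨by rw [hqdef, Int.span_natAbs, hg]⟩
    -- `q ≠ p`: otherwise `P` lies above `p` and `P ∩ K₀ = v₀`
    have hqp : q ≠ p := by
      intro hqp
      haveI : P.LiesOver (Ideal.span {(p : ℤ)}) := by rw [← hqp]; exact hPq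
      haveI : (P.under (𝓞 K₀)).IsPrime := Ideal.IsPrime.under _ P
      haveI : (P.under (𝓞 K₀)).LiesOver (Ideal.span {(p : ℤ)}) :=
        ⟨by rw [Ideal.under_under]; exact Ideal.LiesOver.over⟩
      exact hne (IsCyclotomicExtension.Rat.eq_span_zeta_sub_one_of_liesOver p k K₀ hζK₀
        (P.under (𝓞 K₀)))
    -- `e(P | ℤ) = 1`, hence `e(P | K₀) = 1`
    have hndvd : ¬ q ∣ p ^ (k + 1 + j) := fun h =>
      hqp ((Nat.prime_dvd_prime_iff_eq hq hp).mp (hq.dvd_of_dvd_pow h))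
    have heZ : P.ramificationIdx ℤ = 1 :=
      IsCyclotomicExtension.Rat.ramificationIdx_eq_of_not_dvd (p := q) (K := L) (P := P) hndvd
    have htower : P.ramificationIdx ℤ = (P.under (𝓞 K₀)).ramificationIdx ℤ * P.ramificationIdx (𝓞 K₀) :=
      Ideal.ramificationIdx_tower (P.under (𝓞 K₀)) P
    rw [heZ] at htower
    exact (Ideal.ramificationIdx_eq_one_iff).mp (Nat.eq_one_of_mul_eq_one_left htower.symm)
  exact dvd_classNumber_of_isPGroup_of_dvd_classNumber K₀ L hG v₀ hunr hdvd

/-- **Washington Cor. 10.5: `p ∣ h(ℚ(ζ_{p^{k+1}})) ⟺ p ∣ h(ℚ(ζ_{p^{k+1+j}}))`** (`p^{k+1} ≠ 2`); in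
particular `p` is regular iff `p ∤ h(ℚ(ζ_{pⁿ}))` for all (equivalently some) `n ≥ 1`.
[cite: Washington1997, Cor. 10.5] -/
theorem dvd_classNumber_iff_of_isCyclotomicExtension_prime_pow {p k j : ℕ} (hp : p.Prime)
    (h2 : p ^ (k + 1) ≠ 2) (K L : Type) [Field K] [NumberField K] [Field L] [NumberField L]
    [IsCyclotomicExtension {p ^ (k + 1)} ℚ K] [IsCyclotomicExtension {p ^ (k + 1 + j)} ℚ L] :
    p ∣ classNumber K ↔ p ∣ classNumber L :=
  ⟨fun h => h.trans (classNumber_dvd_classNumber_of_isCyclotomicExtension_prime_pow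
      (a := k + 1) (b := k + 1 + j) hp (Nat.le_add_right (k + 1) j) K L),
    dvd_classNumber_of_isCyclotomicExtension_prime_pow_of_dvd (k := k) (j := j) hp h2 K L⟩

/-! ### Over `ℚ`: `h_ℚ = 1` -/

/-- **A Galois `p`-extension of `ℚ` unramified at the infinite places and at every prime not above a
single prime of `ℚ` has class number prime to `p`** (Washington Thm. 10.4 with `K = ℚ`, `h_ℚ = 1`;
e.g. the layers of the cyclotomic `ℤ_p`-extension of `ℚ`). [cite: Washington1997, Thm. 10.4] -/
theorem not_dvd_classNumber_of_isPGroup_of_rat {p : ℕ} [hp : Fact p.Prime] (L : Type) [Field L]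
    [NumberField L] [IsGalois ℚ L] (hG : IsPGroup p (L ≃ₐ[ℚ] L)) [IsUnramifiedAtInfinitePlaces ℚ L]
    (v₀ : HeightOneSpectrum (𝓞 ℚ))
    (hunr : ∀ (P : Ideal (𝓞 L)) [P.IsMaximal], P.under (𝓞 ℚ) ≠ v₀.asIdeal →
      Algebra.IsUnramifiedAt (𝓞 ℚ) P) :
    ¬ p ∣ classNumber L := fun h => by
  have h1 := dvd_classNumber_of_isPGroup_of_dvd_classNumber ℚ L hG v₀ hunr h
  rw [Rat.classNumber_eq, Nat.dvd_one] at h1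
  exact hp.out.ne_one h1

/-- A totally real field is unramified at the infinite places over any subfield. [folklore] -/
private theorem isUnramifiedAtInfinitePlaces_of_isTotallyReal (K L : Type*) [Field K] [Field L]
    [Algebra K L] [IsTotallyReal L] : IsUnramifiedAtInfinitePlaces K L :=
  ⟨fun w => (IsTotallyReal.isReal w).isUnramified K⟩

/-- **A totally real Galois `p`-extension of `ℚ` unramified outside one prime has class number prime
to `p`** (e.g. the layers `ℚ(ζ_{p^{n+1}})⁺ ⊇ 𝔹_n` of the cyclotomic `ℤ_p`-extension, the cyclic field
of degree `p` inside `ℚ(ζ_q)`, `q ≡ 1 (mod p)`). [cite: Washington1997, Thm. 10.4] -/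
theorem not_dvd_classNumber_of_isPGroup_of_isTotallyReal {p : ℕ} [Fact p.Prime] (L : Type)
    [Field L] [NumberField L] [IsGalois ℚ L] [IsTotallyReal L] (hG : IsPGroup p (L ≃ₐ[ℚ] L))
    (v₀ : HeightOneSpectrum (𝓞 ℚ))
    (hunr : ∀ (P : Ideal (𝓞 L)) [P.IsMaximal], P.under (𝓞 ℚ) ≠ v₀.asIdeal →
      Algebra.IsUnramifiedAt (𝓞 ℚ) P) :
    ¬ p ∣ classNumber L := by
  haveI := isUnramifiedAtInfinitePlaces_of_isTotallyReal ℚ L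
  exact not_dvd_classNumber_of_isPGroup_of_rat L hG v₀ hunr

/-! ### The base `ℚ(ζ_p)`, `p` odd -/

/-- **Washington Cor. 10.5 from the bottom of the tower: for an odd prime `p` and every `n`,
`p ∣ h(ℚ(ζ_p)) ⟺ p ∣ h(ℚ(ζ_{p^{n+1}}))`** — `p` is irregular iff `p` divides the class number of
some (equivalently every) `ℚ(ζ_{pⁿ⁺¹})`. [cite: Washington1997, Cor. 10.5] -/
theorem dvd_classNumber_iff_of_isCyclotomicExtension_prime {p n : ℕ} (hp : p.Prime) (hodd : p ≠ 2)
    (K L : Type) [Field K] [NumberField K] [Field L] [NumberField L]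
    [IsCyclotomicExtension {p} ℚ K] [IsCyclotomicExtension {p ^ (n + 1)} ℚ L] :
    p ∣ classNumber K ↔ p ∣ classNumber L := by
  haveI : IsCyclotomicExtension {p ^ (0 + 1)} ℚ K := by
    rw [zero_add, pow_one]; infer_instance
  haveI : IsCyclotomicExtension {p ^ (0 + 1 + n)} ℚ L := by
    rw [show 0 + 1 + n = n + 1 by ring]; infer_instance
  exact dvd_classNumber_iff_of_isCyclotomicExtension_prime_pow (k := 0) (j := n) hp
    (by rw [zero_add, pow_one]; exact hodd) K L

/-- In particular **a regular prime `p` (odd, `p ∤ h(ℚ(ζ_p))`) does not divide the class number of any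
`ℚ(ζ_{p^{n+1}})`.** [cite: Washington1997, Cor. 10.5] -/
theorem not_dvd_classNumber_of_isCyclotomicExtension_prime_pow_of_regular {p n : ℕ} (hp : p.Prime)
    (hodd : p ≠ 2) (K L : Type) [Field K] [NumberField K] [Field L] [NumberField L]
    [IsCyclotomicExtension {p} ℚ K] [IsCyclotomicExtension {p ^ (n + 1)} ℚ L]
    (hreg : ¬ p ∣ classNumber K) : ¬ p ∣ classNumber L :=
  fun h => hreg ((dvd_classNumber_iff_of_isCyclotomicExtension_prime (n := n) hp hodd K L).mpr h)

end Literature.NumberTheory.NumberFields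

end
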